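import Mathlib
import HarnessLib
import Summits.CriticalPhenomena.CardyFormulaZ2.Theses.CardyStressTensorWard

/-!
# Birth skeleton of the split child `VariationSuperposition` (stmt-CriticalPhenomena-18767) of `HadamardRegularity`

`VariationSuperposition ⇐ stub_baseShift ∧ stub_secondOrder` — superposition of asymptotic first variations cut
along the COMPOSITION OF DEFORMATIONS: `Θ_ε = id + ε(V+W)` on `R̄` is compared with the two-step deformation
`Ψ_ε ∘ Φ_ε` (`Φ_ε = id + εV` on `R̄`, `Ψ_ε = id + εW` globally):

* `stub_baseShift`   — CONTINUITY OF THE LINEAR RESPONSE IN THE BASE DOMAIN: the `W`-increment of the crossing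
  probability measured at the moved domain `Φ_ε(R)` equals the `W`-increment at `R` up to `o(ε)` (mesh-uniformly);
* `stub_secondOrder` — SECOND-ORDER REPARAMETRISATION DEFECT: `(Ψ_ε ∘ Φ_ε)(R)` and `Θ_ε(R)` differ by
  `ε(W∘Φ_ε − W) = O(ε²)` in `C¹`, hence their crossing probabilities by `o(ε)` (two-field Lipschitz technology, as
  in the sibling child `DeformationLipschitz`).

Composition (sorry-free): telescope `P(Θ_εR) − P(Θ_0R)` through `(Φ_εR).map Ψ_ε`, `Φ_εR`, `Ψ_εR`; the standard
global families `Φ`, `Ψ` exist by the contraction principle (`exists_family`), and `R.map (Φ 0) = R.map (Θ 0) =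
R.map (Ψ 0)`-type bookkeeping is `map_congr` (`MarkedDomain.map` depends only on the homeomorphism on `closure R`).
Strategist `cstrat-stmt-CriticalPhenomena-4567-r1` (written under the parent's `Cruxes/HadamardRegularity/Lines/`).
-/

noncomputable section

namespace Summit.CriticalPhenomena.CardyFormulaZ2.Cruxes.HadamardRegularity.BirthVariationSuperposition

open scoped Topology NNReal Manifold ContDiff
open Filter Set Function Metric
open Literature.Probability.Percolation Literature.Probability.RandomPlanarGeometry

/-- Stub 1 — continuity of the linear response in the base domain (increments of increments are `o(ε)`). -/
theorem stub_baseShift :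
    (open Literature.Probability.Percolation Literature.Probability.LatticeModels Literature.Probability.RandomPlanarGeometry in ∀ (R : ConformalRectangle) (V W : ℂ → ℂ), ContDiff ℝ 2 V → (∃ B : ℝ, ∀ z : ℂ, ‖V z‖ ≤ B * (1 + ‖z‖) ∧ ‖fderiv ℝ V z‖ ≤ B) → ContDiff ℝ 2 W → (∃ B : ℝ, ∀ z : ℂ, ‖W z‖ ≤ B * (1 + ‖z‖) ∧ ‖fderiv ℝ W z‖ ≤ B) → ∀ Φ : ℝ → ℂ ≃ₜ ℂ, (∀ᶠ ε in 𝓝 (0:ℝ), ∀ z ∈ closure R.carrier, Φ ε z = z + (ε : ℂ) * V z) → ∀ Ψ : ℝ → ℂ ≃ₜ ℂ, (∀ᶠ ε in 𝓝 (0:ℝ), ∀ z : ℂ, Ψ ε z = z + (ε : ℂ) * W z) → ∀ η : ℝ, 0 < η → ∀ᶠ ε in 𝓝 (0:ℝ), ∀ᶠ δ in 𝓝[>] (0:ℝ), |(bondDomainCrossingProb ((R.map (Φ ε)).map (Ψ ε)) δ - bondDomainCrossingProb (R.map (Φ ε)) δ) - (bondDomainCrossingProb (R.map (Ψ ε)) δ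 - bondDomainCrossingProb (R.map (Ψ 0)) δ)| ≤ η * |ε|) := by
  sorry

/-- Stub 2 — the reparametrisation defect `(Ψ_ε ∘ Φ_ε)(R)` vs `Θ_ε(R)` is second order. -/
theorem stub_secondOrder :
    (open Literature.Probability.Percolation Literature.Probability.LatticeModels Literature.Probability.RandomPlanarGeometry in ∀ (R : ConformalRectangle) (V W : ℂ → ℂ), ContDiff ℝ 2 V → (∃ B : ℝ, ∀ z : ℂ, ‖V z‖ ≤ B * (1 + ‖z‖) ∧ ‖fderiv ℝ V z‖ ≤ B) → ContDiff ℝ 2 W → (∃ B : ℝ, ∀ z : ℂ, ‖W z‖ ≤ B * (1 + ‖z‖) ∧ ‖fderiv ℝ W z‖ ≤ B) → ∀ Φ : ℝ → ℂ ≃ₜ ℂ, (∀ᶠ ε in 𝓝 (0:ℝ), ∀ z ∈ closure R.carrier, Φ ε z = z + (ε : ℂ) * V z) → ∀ Ψ : ℝ → ℂ ≃ₜ ℂ, (∀ᶠ ε in 𝓝 (0:ℝ), ∀ z : ℂ, Ψ ε z = z + (ε : ℂ) * W z) → ∀ Θ : ℝ → ℂ ≃ₜ ℂ, (∀ᶠ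 ε in 𝓝 (0:ℝ), ∀ z ∈ closure R.carrier, Θ ε z = z + (ε : ℂ) * (V z + W z)) → ∀ η : ℝ, 0 < η → ∀ᶠ ε in 𝓝 (0:ℝ), ∀ᶠ δ in 𝓝[>] (0:ℝ), |bondDomainCrossingProb ((R.map (Φ ε)).map (Ψ ε)) δ - bondDomainCrossingProb (R.map (Θ ε)) δ| ≤ η * |ε|) := by
  sorry

/-! ### §0 Vocabulary (data-valued helpers) -/

/-- The admissible deformation fields of `HadamardRegularity` — `C²` fields of linear growth with bounded
derivative — as an `ℝ`-submodule of `ℂ → ℂ`. [folklore] -/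
def niceSub : Submodule ℝ (ℂ → ℂ) where
  carrier := {V | ContDiff ℝ 2 V ∧ ∃ B : ℝ, ∀ z : ℂ, ‖V z‖ ≤ B * (1 + ‖z‖) ∧ ‖fderiv ℝ V z‖ ≤ B}
  add_mem' := by
    rintro V W ⟨hV, B, hB⟩ ⟨hW, B', hB'⟩
    have hdV : Differentiable ℝ V := hV.differentiable (by norm_num)
    have hdW : Differentiable ℝ W := hW.differentiable (by norm_num)
    refine ⟨hV.add hW, B + B', fun z => ⟨?_, ?_⟩⟩
    · calc ‖(V + W) z‖ = ‖V z + W z‖ := rfl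
        _ ≤ ‖V z‖ + ‖W z‖ := norm_add_le _ _
        _ ≤ B * (1 + ‖z‖) + B' * (1 + ‖z‖) := add_le_add (hB z).1 (hB' z).1
        _ = (B + B') * (1 + ‖z‖) := by ring
    · have h : fderiv ℝ (V + W) z = fderiv ℝ V z + fderiv ℝ W z :=
        fderiv_add (hdV z) (hdW z)
      rw [h]
      exact (norm_add_le _ _).trans (add_le_add (hB z).2 (hB' z).2)
  zero_mem' := by
    refine ⟨contDiff_const, 0, fun z => ⟨by simp, ?_⟩⟩
    simp
  smul_mem' := by
    rintro c V ⟨hV, B, hB⟩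
    have hdV : Differentiable ℝ V := hV.differentiable (by norm_num)
    refine ⟨hV.const_smul c, ‖c‖ * B, fun z => ⟨?_, ?_⟩⟩
    · calc ‖(c • V) z‖ = ‖c‖ * ‖V z‖ := by simp
        _ ≤ ‖c‖ * (B * (1 + ‖z‖)) := mul_le_mul_of_nonneg_left (hB z).1 (norm_nonneg _)
        _ = ‖c‖ * B * (1 + ‖z‖) := by ring
    · have h : fderiv ℝ (c • V) z = c • fderiv ℝ V z := fderiv_const_smul (hdV z) c
      rw [h, norm_smul]
      exact mul_le_mul_of_nonneg_left (hB z).2 (norm_nonneg _)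

/-- Families of plane homeomorphisms whose germ at `ε = 0` deforms `R̄` by `id + εV` (only the values on
`closure R.carrier` matter for `R.map`). [folklore] -/
def famSet (R : ConformalRectangle) (V : ℂ → ℂ) : Set (ℝ → ℂ ≃ₜ ℂ) :=
  {Φ | ∀ᶠ ε in 𝓝 (0:ℝ), ∀ z ∈ closure R.carrier, Φ ε z = z + (ε : ℂ) * V z}

/-- Asymptotic (mesh-uniform) first variations of the crossing probability along a family `Φ`. [folklore] -/
def aderivSet (R : ConformalRectangle) (Φ : ℝ → ℂ ≃ₜ ℂ) : Set ℝ :=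
  {L | ∀ η : ℝ, 0 < η → ∀ᶠ ε in 𝓝 (0:ℝ), ∀ᶠ δ in 𝓝[>] (0:ℝ),
    |bondDomainCrossingProb (R.map (Φ ε)) δ - bondDomainCrossingProb (R.map (Φ 0)) δ - ε * L| ≤ η * |ε|}

/-- Asymptotic first variations of the crossing probability of `R` along the field `V`: along EVERY family
with germ `id + εV` on `R̄`. [folklore] -/
def hasVarSet (R : ConformalRectangle) (V : ℂ → ℂ) : Set ℝ :=
  {L | ∀ Φ ∈ famSet R V, L ∈ aderivSet R Φ}

/-! ### §1 The image marked domain depends only on the homeomorphism on the closure -/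

theorem jordanDomain_eq {D E : JordanDomain} (hc : D.carrier = E.carrier) (hb : D.boundary = E.boundary) :
    D = E := by
  obtain ⟨c, b, _, _, _, _, _, _, _⟩ := D
  obtain ⟨c', b', _, _, _, _, _, _, _⟩ := E
  simp only at hc hb
  subst hc
  subst hb
  rfl

theorem markedDomain_eq {n : ℕ} {D E : MarkedDomain n} (h : D.toJordanDomain = E.toJordanDomain)
    (hm : D.mark = E.mark) : D = E := by
  obtain ⟨J, m, _, _⟩ := D
  obtain ⟨J', m', _, _⟩ := E
  simp only at h hm
  subst h
  subst hm
  rfl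

/-- `R.map φ` depends only on `φ` restricted to `closure R.carrier` (carrier image and boundary loop). [folklore] -/
theorem map_congr (R : ConformalRectangle) {φ ψ : ℂ ≃ₜ ℂ} (h : ∀ z ∈ closure R.carrier, φ z = ψ z) :
    R.map φ = R.map ψ := by
  refine markedDomain_eq (jordanDomain_eq ?_ ?_) rfl
  · show φ '' R.carrier = ψ '' R.carrier
    exact image_congr fun z hz => h z (subset_closure hz)
  · show (φ : ℂ → ℂ) ∘ R.boundary = ψ ∘ R.boundary
    funext t
    exact h _ (by rw [R.toJordanDomain.closure_eq]; exact Or.inr (mem_range_self t))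

/-! ### §2 The homeomorphisms `z ↦ z + ε V z` (contraction principle) -/

theorem lipschitz_of_mem {V : ℂ → ℂ} (hV : V ∈ niceSub) : ∃ K : ℝ≥0, LipschitzWith K V := by
  obtain ⟨hV, B, hB⟩ := hV
  refine ⟨B.toNNReal, lipschitzWith_of_nnnorm_fderiv_le (hV.differentiable (by norm_num)) fun z => ?_⟩
  rw [← NNReal.coe_le_coe, coe_nnnorm]
  exact (hB z).2.trans (Real.le_coe_toNNReal B)

theorem perturb_inverse {V : ℂ → ℂ} {K : ℝ≥0} (hV : LipschitzWith K V) {ε : ℝ} (hε : |ε| * K ≤ 1 / 2) :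
    ∃ g : ℂ → ℂ, LipschitzWith 2 g ∧ Function.LeftInverse g (fun z => z + (ε:ℂ) * V z) ∧
      Function.RightInverse g (fun z => z + (ε:ℂ) * V z) := by
  -- `T y x = y - ε V x` is a contraction for every `y`
  have hT : ∀ y : ℂ, ContractingWith (‖ε‖₊ * K) (fun x => y - (ε:ℂ) * V x) := by
    intro y
    refine ⟨?_, LipschitzWith.of_dist_le_mul fun a b => ?_⟩
    · rw [← NNReal.coe_lt_coe, NNReal.coe_mul, coe_nnnorm, Real.norm_eq_abs]
      push_cast
      linarith
    · have h1 := hV.dist_le_mul a b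
      rw [dist_eq_norm, dist_eq_norm] at *
      calc ‖y - (ε:ℂ) * V a - (y - (ε:ℂ) * V b)‖ = ‖(ε:ℂ) * (V b - V a)‖ := by ring_nf
        _ = |ε| * ‖V a - V b‖ := by rw [norm_mul, Complex.norm_real, Real.norm_eq_abs, norm_sub_rev]
        _ ≤ |ε| * (K * ‖a - b‖) := mul_le_mul_of_nonneg_left h1 (abs_nonneg _)
        _ = (‖ε‖₊ * K : ℝ≥0) * ‖a - b‖ := by push_cast; rw [Real.norm_eq_abs]; ring
  set g : ℂ → ℂ := fun y => ContractingWith.fixedPoint _ (hT y) with hg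
  have hfix : ∀ y, y - (ε:ℂ) * V (g y) = g y := fun y => ContractingWith.fixedPoint_isFixedPt (hT y)
  have hεK : |ε| * K ≤ 1 / 2 := hε
  refine ⟨g, LipschitzWith.of_dist_le_mul fun y y' => ?_, fun x => ?_, fun y => ?_⟩
  · have h1 := hV.dist_le_mul (g y) (g y')
    rw [dist_eq_norm, dist_eq_norm] at *
    have h2 : g y - g y' = (y - y') - (ε:ℂ) * (V (g y) - V (g y')) := by
      linear_combination (-1 : ℂ) * hfix y + hfix y'
    have h3 : ‖g y - g y'‖ ≤ ‖y - y'‖ + |ε| * (K * ‖g y - g y'‖) := by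
      calc ‖g y - g y'‖ = ‖(y - y') - (ε:ℂ) * (V (g y) - V (g y'))‖ := by rw [h2]
        _ ≤ ‖y - y'‖ + ‖(ε:ℂ) * (V (g y) - V (g y'))‖ := norm_sub_le _ _
        _ ≤ ‖y - y'‖ + |ε| * (K * ‖g y - g y'‖) := by
          refine add_le_add le_rfl ?_
          rw [norm_mul, Complex.norm_real, Real.norm_eq_abs]
          exact mul_le_mul_of_nonneg_left h1 (abs_nonneg _)
    have h4 : |ε| * (K * ‖g y - g y'‖) ≤ (1 / 2) * ‖g y - g y'‖ := by
      rw [← mul_assoc]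
      exact mul_le_mul_of_nonneg_right hεK (norm_nonneg _)
    push_cast
    linarith
  · -- `x` is a fixed point of `T (x + ε V x)`
    symm
    refine ContractingWith.fixedPoint_unique (hT (x + (ε:ℂ) * V x)) ?_
    show x + (ε:ℂ) * V x - (ε:ℂ) * V x = x
    ring
  · show g y + (ε:ℂ) * V (g y) = y
    have := hfix y
    linear_combination (-1 : ℂ) * this

/-- The homeomorphism `z ↦ z + ε V z` of the plane, for `V` `K`-Lipschitz and `|ε| K ≤ 1/2`. [folklore] -/
def perturbHomeomorph {V : ℂ → ℂ} {K : ℝ≥0} (hV : LipschitzWith K V) {ε : ℝ} (hε : |ε| * K ≤ 1 / 2) :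
    ℂ ≃ₜ ℂ where
  toFun z := z + (ε:ℂ) * V z
  invFun := (perturb_inverse hV hε).choose
  left_inv := (perturb_inverse hV hε).choose_spec.2.1
  right_inv := (perturb_inverse hV hε).choose_spec.2.2
  continuous_toFun := continuous_id.add (continuous_const.mul hV.continuous)
  continuous_invFun := (perturb_inverse hV hε).choose_spec.1.continuous

/-- Every admissible field generates a family of plane homeomorphisms equal to `id + εV` near `ε = 0`. [folklore] -/
theorem exists_family {V : ℂ → ℂ} (hV : V ∈ niceSub) :
    ∃ Φ : ℝ → ℂ ≃ₜ ℂ, ∀ᶠ ε in 𝓝 (0:ℝ), ∀ z : ℂ, Φ ε z = z + (ε:ℂ) * V z := by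
  classical
  obtain ⟨K, hK⟩ := lipschitz_of_mem hV
  refine ⟨fun ε => if h : |ε| * K ≤ 1 / 2 then perturbHomeomorph hK h else Homeomorph.refl ℂ, ?_⟩
  have hc : Continuous (fun ε : ℝ => |ε| * (K:ℝ)) := by fun_prop
  have ht : Tendsto (fun ε : ℝ => |ε| * (K:ℝ)) (𝓝 0) (𝓝 0) := by simpa using hc.tendsto 0
  have hev : ∀ᶠ ε in 𝓝 (0:ℝ), |ε| * (K:ℝ) ≤ 1 / 2 :=
    (ht.eventually (eventually_lt_nhds (by norm_num : (0:ℝ) < 1 / 2))).mono fun ε h => h.le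
  filter_upwards [hev] with ε hε z
  simp only [dif_pos hε]
  rfl

theorem mem_famSet_of_forall {R : ConformalRectangle} {V : ℂ → ℂ} {Φ : ℝ → ℂ ≃ₜ ℂ}
    (h : ∀ᶠ ε in 𝓝 (0:ℝ), ∀ z : ℂ, Φ ε z = z + (ε:ℂ) * V z) : Φ ∈ famSet R V :=
  h.mono fun _ hε z _ => hε z


/-! ### Composition -/

/-- Composition lemma (sorry-free): base-point continuity + second-order defect ⟹ superposition. -/
theorem variationSuperposition_of_pieces :
    (open Literature.Probability.Percolation Literature.Probability.LatticeModels Literature.Probability.RandomPlanarGeometry in ∀ (R : ConformalRectangle) (V W : ℂ → ℂ), ContDiff ℝ 2 V → (∃ B : ℝ, ∀ z : ℂ, ‖V z‖ ≤ B * (1 + ‖z‖) ∧ ‖fderiv ℝ V z‖ ≤ B) → ContDiff ℝ 2 W → (∃ B : ℝ, ∀ z : ℂ, ‖W z‖ ≤ B * (1 + ‖z‖) ∧ ‖fderiv ℝ W z‖ ≤ B) → ∀ Φ : ℝ → ℂ ≃ₜ ℂ, (∀ᶠ ε in 𝓝 (0:ℝ), ∀ z ∈ closure R.carrier, Φ ε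 z = z + (ε : ℂ) * V z) → ∀ Ψ : ℝ → ℂ ≃ₜ ℂ, (∀ᶠ ε in 𝓝 (0:ℝ), ∀ z : ℂ, Ψ ε z = z + (ε : ℂ) * W z) → ∀ η : ℝ, 0 < η → ∀ᶠ ε in 𝓝 (0:ℝ), ∀ᶠ δ in 𝓝[>] (0:ℝ), |(bondDomainCrossingProb ((R.map (Φ ε)).map (Ψ ε)) δ - bondDomainCrossingProb (R.map (Φ ε)) δ) - (bondDomainCrossingProb (R.map (Ψ ε)) δ - bondDomainCrossingProb (R.map (Ψ 0)) δ)| ≤ η * |ε|) →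
    (open Literature.Probability.Percolation Literature.Probability.LatticeModels Literature.Probability.RandomPlanarGeometry in ∀ (R : ConformalRectangle) (V W : ℂ → ℂ), ContDiff ℝ 2 V → (∃ B : ℝ, ∀ z : ℂ, ‖V z‖ ≤ B * (1 + ‖z‖) ∧ ‖fderiv ℝ V z‖ ≤ B) → ContDiff ℝ 2 W → (∃ B : ℝ, ∀ z : ℂ, ‖W z‖ ≤ B * (1 + ‖z‖) ∧ ‖fderiv ℝ W z‖ ≤ B) → ∀ Φ : ℝ → ℂ ≃ₜ ℂ, (∀ᶠ ε in 𝓝 (0:ℝ), ∀ z ∈ closure R.carrier, Φ ε z = z + (ε : ℂ) * V z) → ∀ Ψ : ℝ → ℂ ≃ₜ ℂ, (∀ᶠ ε in 𝓝 (0:ℝ), ∀ z : ℂ, Ψ ε z = z + (ε : ℂ) * W z) → ∀ Θ : ℝ → ℂ ≃ₜ ℂ, (∀ᶠ ε in 𝓝 (0:ℝ), ∀ z ∈ closure R.carrier, Θ ε z = z + (ε : ℂ) * (V z + W z)) → ∀ η : ℝ, 0 < η → ∀ᶠ ε in 𝓝 (0:ℝ), ∀ᶠ δ in 𝓝[>]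 (0:ℝ), |bondDomainCrossingProb ((R.map (Φ ε)).map (Ψ ε)) δ - bondDomainCrossingProb (R.map (Θ ε)) δ| ≤ η * |ε|) →
    (open Literature.Probability.Percolation Literature.Probability.LatticeModels Literature.Probability.RandomPlanarGeometry in ∀ (R : ConformalRectangle) (V W : ℂ → ℂ) (L M : ℝ), ContDiff ℝ 2 V → (∃ B : ℝ, ∀ z : ℂ, ‖V z‖ ≤ B * (1 + ‖z‖) ∧ ‖fderiv ℝ V z‖ ≤ B) → ContDiff ℝ 2 W → (∃ B : ℝ, ∀ z : ℂ, ‖W z‖ ≤ B * (1 + ‖z‖) ∧ ‖fderiv ℝ W z‖ ≤ B) → (∀ Φ : ℝ → ℂ ≃ₜ ℂ, (∀ᶠ ε in 𝓝 (0:ℝ), ∀ z ∈ closure R.carrier, Φ ε z = z + (ε : ℂ) * V z) → ∀ η : ℝ, 0 < η → ∀ᶠ ε in 𝓝 (0:ℝ), ∀ᶠ δ in 𝓝[>] (0:ℝ), |bondDomainCrossingProb (R.map (Φ ε)) δ - bondDomainCrossingProb (R.map (Φ 0)) δ - ε * L| ≤ η * |ε|) → (∀ Φ : ℝ → ℂ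 ≃ₜ ℂ, (∀ᶠ ε in 𝓝 (0:ℝ), ∀ z ∈ closure R.carrier, Φ ε z = z + (ε : ℂ) * W z) → ∀ η : ℝ, 0 < η → ∀ᶠ ε in 𝓝 (0:ℝ), ∀ᶠ δ in 𝓝[>] (0:ℝ), |bondDomainCrossingProb (R.map (Φ ε)) δ - bondDomainCrossingProb (R.map (Φ 0)) δ - ε * M| ≤ η * |ε|) → ∀ Φ : ℝ → ℂ ≃ₜ ℂ, (∀ᶠ ε in 𝓝 (0:ℝ), ∀ z ∈ closure R.carrier, Φ ε z = z + (ε : ℂ) * (V z + W z)) → ∀ η : ℝ, 0 < η → ∀ᶠ ε in 𝓝 (0:ℝ), ∀ᶠ δ in 𝓝[>] (0:ℝ), |bondDomainCrossingProb (R.map (Φ ε)) δ - bondDomainCrossingProb (R.map (Φ 0)) δ - ε * (L + M)| ≤ η * |ε|) := by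
  intro hB hS R V W L M hV1 hV2 hW1 hW2 hL hM Θ hΘ η hη
  have hV : V ∈ niceSub := ⟨hV1, hV2⟩
  have hW : W ∈ niceSub := ⟨hW1, hW2⟩
  obtain ⟨Φ, hΦ⟩ := exists_family hV
  obtain ⟨Ψ, hΨ⟩ := exists_family hW
  have hΦ' : ∀ᶠ ε in 𝓝 (0:ℝ), ∀ z ∈ closure R.carrier, Φ ε z = z + (ε : ℂ) * V z := hΦ.mono fun _ h z _ => h z
  have hΨ' : ∀ᶠ ε in 𝓝 (0:ℝ), ∀ z ∈ closure R.carrier, Ψ ε z = z + (ε : ℂ) * W z := hΨ.mono fun _ h z _ => h z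
  have hη4 : 0 < η / 4 := by positivity
  have h1 := hL Φ hΦ' (η / 4) hη4
  have h2 := hM Ψ hΨ' (η / 4) hη4
  have h3 := hB R V W hV1 hV2 hW1 hW2 Φ hΦ' Ψ hΨ (η / 4) hη4
  have h4 := hS R V W hV1 hV2 hW1 hW2 Φ hΦ' Ψ hΨ Θ hΘ (η / 4) hη4
  -- `Φ 0 = Θ 0 = id` on `R̄`, so the reference domains agree
  have h0 : R.map (Φ 0) = R.map (Θ 0) := by
    refine map_congr R fun z hz => ?_
    rw [hΦ'.self_of_nhds z hz, hΘ.self_of_nhds z hz]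
    push_cast
    ring
  filter_upwards [h1, h2, h3, h4] with ε e1 e2 e3 e4
  filter_upwards [e1, e2, e3, e4] with δ d1 d2 d3 d4
  rw [← h0]
  have key : bondDomainCrossingProb (R.map (Θ ε)) δ - bondDomainCrossingProb (R.map (Φ 0)) δ - ε * (L + M) =
      -(bondDomainCrossingProb ((R.map (Φ ε)).map (Ψ ε)) δ - bondDomainCrossingProb (R.map (Θ ε)) δ) +
      ((bondDomainCrossingProb ((R.map (Φ ε)).map (Ψ ε)) δ - bondDomainCrossingProb (R.map (Φ ε)) δ) -
        (bondDomainCrossingProb (R.map (Ψ ε)) δ - bondDomainCrossingProb (R.map (Ψ 0)) δ)) +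
      (bondDomainCrossingProb (R.map (Φ ε)) δ - bondDomainCrossingProb (R.map (Φ 0)) δ - ε * L) +
      (bondDomainCrossingProb (R.map (Ψ ε)) δ - bondDomainCrossingProb (R.map (Ψ 0)) δ - ε * M) := by ring
  rw [key]
  have eA : |-(bondDomainCrossingProb ((R.map (Φ ε)).map (Ψ ε)) δ - bondDomainCrossingProb (R.map (Θ ε)) δ)| ≤
      η / 4 * |ε| := by rw [abs_neg]; exact d4
  calc _ ≤ |-(bondDomainCrossingProb ((R.map (Φ ε)).map (Ψ ε)) δ - bondDomainCrossingProb (R.map (Θ ε)) δ) +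
      ((bondDomainCrossingProb ((R.map (Φ ε)).map (Ψ ε)) δ - bondDomainCrossingProb (R.map (Φ ε)) δ) -
        (bondDomainCrossingProb (R.map (Ψ ε)) δ - bondDomainCrossingProb (R.map (Ψ 0)) δ)) +
      (bondDomainCrossingProb (R.map (Φ ε)) δ - bondDomainCrossingProb (R.map (Φ 0)) δ - ε * L)| +
      |bondDomainCrossingProb (R.map (Ψ ε)) δ - bondDomainCrossingProb (R.map (Ψ 0)) δ - ε * M| := abs_add_le _ _
    _ ≤ |-(bondDomainCrossingProb ((R.map (Φ ε)).map (Ψ ε)) δ - bondDomainCrossingProb (R.map (Θ ε)) δ) +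
      ((bondDomainCrossingProb ((R.map (Φ ε)).map (Ψ ε)) δ - bondDomainCrossingProb (R.map (Φ ε)) δ) -
        (bondDomainCrossingProb (R.map (Ψ ε)) δ - bondDomainCrossingProb (R.map (Ψ 0)) δ))| +
      |bondDomainCrossingProb (R.map (Φ ε)) δ - bondDomainCrossingProb (R.map (Φ 0)) δ - ε * L| +
      |bondDomainCrossingProb (R.map (Ψ ε)) δ - bondDomainCrossingProb (R.map (Ψ 0)) δ - ε * M| :=
        add_le_add (abs_add_le _ _) le_rfl
    _ ≤ |-(bondDomainCrossingProb ((R.map (Φ ε)).map (Ψ ε)) δ - bondDomainCrossingProb (R.map (Θ ε)) δ)| +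
      |(bondDomainCrossingProb ((R.map (Φ ε)).map (Ψ ε)) δ - bondDomainCrossingProb (R.map (Φ ε)) δ) -
        (bondDomainCrossingProb (R.map (Ψ ε)) δ - bondDomainCrossingProb (R.map (Ψ 0)) δ)| +
      |bondDomainCrossingProb (R.map (Φ ε)) δ - bondDomainCrossingProb (R.map (Φ 0)) δ - ε * L| +
      |bondDomainCrossingProb (R.map (Ψ ε)) δ - bondDomainCrossingProb (R.map (Ψ 0)) δ - ε * M| :=
        add_le_add (add_le_add (abs_add_le _ _) le_rfl) le_rfl
    _ ≤ η / 4 * |ε| + η / 4 * |ε| + η / 4 * |ε| + η / 4 * |ε| := add_le_add (add_le_add (add_le_add eA d3) d1) d2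
    _ = η * |ε| := by ring

/-- **Registered composition BY NAME** (`ledger skeleton check --crux <child item>`): the ROUTE DECL
`CardyStressTensorWard.VariationSuperposition` (rev-5 route file) from the two sorried stubs `stub_baseShift`,
`stub_secondOrder` through the sorry-free composition lemma `variationSuperposition_of_pieces` (the decl's body is
definitionally that lemma's conclusion). No sorry here; the only sorries of the file are the two stubs. -/
theorem VariationSuperposition_of :
    Summit.CriticalPhenomena.CardyFormulaZ2.Theses.CardyStressTensorWard.VariationSuperposition :=
  variationSuperposition_of_pieces stub_baseShift stub_secondOrder

end Summit.CriticalPhenomena.CardyFormulaZ2.Cruxes.HadamardRegularity.BirthVariationSuperposition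

end
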